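import Summits.Ventures.PercRepro.ThetaOmegaGraphMono

/-!
# The graph form of (Ω): the strictness chain

Addendum 84 suppl. 1–2 (mine-1, gen 45). The SAT certificates of the census come in two kinds: a
STRICTNESS certificate at size `k` («no family of `k` members has at most `k` edge-meets on any
ground set») and a REDUNDANT-TIGHT certificate at size `k` («no FULLY REDUNDANT family of `k`
members — deleting any member loses no counted set — has at most `k` edge-meets»). This file
records the two kernel facts that chain them:

* `fullyRedundant_of_tight` — if every subfamily with one member fewer already has at least `|F|`
  edge-meets (strictness one size down) and `F` has exactly `|F|`, then `F` is fully redundant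
  (the counted families of `F` and of every `F.erase s` coincide);
* `lt_omegaCountG_of_chain` — hence strictness one size down together with the redundant-tight
  certificate at the current size gives strictness at the current size; with
  `card_le_omegaCountG_of_erase` the bound follows one size further up.

So strictness at `k` ⟹ (redundant-tight cell at `k + 1` UNSAT) ⟹ strictness at `k + 1` ⟹ the bound
at `k + 2`; the cells are SAT certificates, the chain itself is kernel-checked.
-/

namespace PercRepro.MSTight

open Finset

variable {α : Type*} [DecidableEq α] {Γ : Slot α → Slot α → Prop} [DecidableRel Γ] {U : Finset α}
  {F : Finset (Finset α)}

/-- **Fully redundant**: deleting any member loses no counted set — the `A`- and `C`-families of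
`F.erase s` are those of `F`, for every member `s`. -/
def FullyRedundant (Γ : Slot α → Slot α → Prop) [DecidableRel Γ] (U : Finset α)
    (F : Finset (Finset α)) : Prop :=
  ∀ s ∈ F, omegaAR Γ (F.erase s) topSlot botSlot = omegaAR Γ F topSlot botSlot ∧
    omegaCR Γ U (F.erase s) botSlot = omegaCR Γ U F botSlot

/-- A family whose subfamilies with one member fewer all have at least `|F|` edge-meets, and which
has exactly `|F|` of them, is fully redundant. -/
theorem fullyRedundant_of_tight (hprev : ∀ s ∈ F, F.card ≤ omegaCountG Γ U (F.erase s))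
    (htight : omegaCountG Γ U F = F.card) : FullyRedundant Γ U F := by
  intro s hs
  have hA := omegaAR_mono (R := Γ) (l0 := topSlot) (l1 := botSlot) (erase_subset s F)
  have hC := omegaCR_mono (R := Γ) (U := U) (l1 := botSlot) (erase_subset s F)
  have h1 := hprev s hs
  have h2 : omegaCountG Γ U (F.erase s) ≤ omegaCountG Γ U F := omegaCountG_mono (erase_subset s F)
  have hAc := card_le_card hA
  have hCc := card_le_card hC
  unfold omegaCountG omegaCountR at h1 h2 htight
  refine ⟨eq_of_subset_of_card_le hA ?_, eq_of_subset_of_card_le hC ?_⟩ <;> omega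

/-- **The chain step**: strictness one size down (every subfamily with one member fewer has at
least `|F|` edge-meets) and the redundant-tight certificate at this size (no fully redundant
family of this size has at most `|F|` edge-meets) give strictness at this size. -/
theorem lt_omegaCountG_of_chain (hprev : ∀ s ∈ F, F.card ≤ omegaCountG Γ U (F.erase s))
    (hcert : FullyRedundant Γ U F → F.card < omegaCountG Γ U F) :
    F.card < omegaCountG Γ U F := by
  rcases F.eq_empty_or_nonempty with hF | hne
  · subst hF
    exact hcert (fun s hs => absurd hs (Finset.notMem_empty s))
  have hle := card_le_omegaCountG_of_erase hne hprev
  rcases lt_or_eq_of_le hle with hlt | heq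
  · exact hlt
  · exact hcert (fullyRedundant_of_tight hprev heq.symm)

end PercRepro.MSTight
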